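import Literature.NumberTheory.LFunctions.TruncatedWeilFormFiniteDictionary
import HarnessLib

/-!
# RH-FREE — «nothing here bears on the truth of RH»: the dimension count `dim(H_s(N) ∩ P_N(c)) = N − s − 1` of Groskin's pole-neutral family (arXiv:2607.02828, Corollary 2.7, clause 1), PROVED

PROOF LAYER (theorems only, 0 defs-as-facts, 0 named facts) for the statement file
`Literature/NumberTheory/LFunctions/TruncatedWeilFormFiniteDictionary.lean` (cell `rh-columns/lit`,
unit `rh-lit-frontier-1` gen 2; namespace `Literature.NumberTheory.LFunctions.Groskin2026`). It proves
the FIRST clause of the claim `corollary_2_7` ([Gr26] A. Groskin, *A finite Guinand–Weil dictionary and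
archimedean tail order for the truncated Weil quadratic form*, arXiv:2607.02828v3, Corollary 2.7, p. 7:
"If `N ≥ s + 2`, then `dim(H_s(N) ∩ P_N(c)) = N − s − 1 > 0`"), in the slightly wider range `N ≥ s + 1`
in which the printed independence argument works (p. 8: "The row defining `P_N(c)` is independent of the
moment rows when `N ≥ s + 1`: otherwise there would be a polynomial `P` of degree at most `s` with
`P(k²) = 1/(k² + β²)` for `0 ≤ k ≤ N`; then `(x + β²)P(x) − 1`, of degree at most `s + 1`, would vanish
at the `N + 1 ≥ s + 2` distinct points `k²`, forcing it to vanish identically, which is impossible. The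
dimension formula follows.").

## Route (the printed one, in linear-algebra dress)

* the pencil `Fin.cons (poleRowLM c N) (M_{2j})_j : Fin (s + 2) → Dual(ℝ^{N+1})` = the pole row followed by
  the moment rows `M₀, M₂, …, M_{2s}` (the statement file's `poleRowLM`, `evenMomentLM`; written inline).
* `linearIndependent_polePencil` (`N ≥ s + 1`): a vanishing combination `b·(pole row) + Σ_j a_j M_{2j}`,
  evaluated on the coordinate vectors `e_k` (`k = 0, …, N`; the weights `ε_k ∈ {1, √2}` are nonzero),
  says that the polynomial `R = b + (X + β²)·Σ_j a_j X^j` of degree `≤ s + 1` vanishes at the `N + 1`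
  distinct reals `k²`; so `R = 0` (`Polynomial.eq_zero_of_natDegree_lt_card_of_eval_eq_zero`), whence
  `Σ_j a_j X^j = 0` by degree count and `b = 0` — exactly the printed argument with `P = −(Σ a_j X^j)/b`.
* `momentNeutral_inf_poleNeutral_eq_dualCoannihilator`: `H_s(N) ∩ P_N(c)` is the dual coannihilator of
  the span of the pencil; `finrank_momentNeutral_inf_poleNeutral`: by
  `Subspace.finrank_add_finrank_dualCoannihilator_eq` and `finrank_span_eq_card`,
  `dim = (N + 1) − (s + 2) = N − s − 1`.

The source is an unrefereed preprint (`[claim: Groskin2026, status: under-review]`); a kernel proof of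
a finite-dimensional dimension count asserts nothing on its authority. The other clauses of
`corollary_2_7` (`g_v ≠ 0`, and `g_v = g_w ⇒ v = ±w`: the Volterra integral-domain argument) are NOT
proved here; `g_v(i/2) = 0` on `P_N(c)` is the statement file's
`testFunction_I_half_eq_zero_of_mem_poleNeutral`. Nothing here bears on Weil positivity or on the
truth of RH.
-/

noncomputable section

open Finset Polynomial

namespace Literature.NumberTheory.LFunctions

namespace Groskin2026

/-- The weights `ε_k ∈ {1, √2}` are nonzero. [cite: Groskin2026, §2.1 (p. 3)] -/
theorem evenWeight_ne_zero (k : ℕ) : evenWeight k ≠ 0 := by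
  unfold evenWeight; split_ifs
  · exact one_ne_zero
  · positivity

/-- `M_{2j}(e_k) = ε_k k^{2j}` on the coordinate vector `e_k`. [cite: Groskin2026, Corollary 2.7 (p. 7)] -/
theorem evenMoment_single (N j : ℕ) (k : Fin (N + 1)) :
    evenMoment N j (Pi.single k 1) = evenWeight k * ((k : ℕ) : ℝ) ^ (2 * j) := by
  classical
  unfold evenMoment
  rw [Finset.sum_eq_single k]
  · simp
  · intro k' _ hk'
    simp [hk']
  · simp

/-- The pole row on the coordinate vector `e_k`: `ε_k/(k² + β²)`. [cite: Groskin2026, Corollary 2.7 (p. 7)] -/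
theorem poleRow_single (c : ℝ) (N : ℕ) (k : Fin (N + 1)) :
    poleRow c N (Pi.single k 1) = evenWeight k / (((k : ℕ) : ℝ) ^ 2 + poleBeta c ^ 2) := by
  classical
  unfold poleRow
  rw [Finset.sum_eq_single k]
  · simp
  · intro k' _ hk'
    simp [hk']
  · simp

/-- The pencil `(pole row, M₀, …, M_{2s})` evaluated at index `0` is the pole row.
[cite: Groskin2026, Corollary 2.7 (p. 7)] -/
theorem polePencil_zero (c : ℝ) (N s : ℕ) :
    (Fin.cons (poleRowLM c N) (fun j : Fin (s + 1) ↦ evenMomentLM N j) :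
      Fin (s + 2) → Module.Dual ℝ (Fin (N + 1) → ℝ)) 0 = poleRowLM c N := by
  simp

/-- The pencil at index `j + 1` is the moment row `M_{2j}`. [cite: Groskin2026, Corollary 2.7 (p. 7)] -/
theorem polePencil_succ (c : ℝ) (N s : ℕ) (j : Fin (s + 1)) :
    (Fin.cons (poleRowLM c N) (fun j : Fin (s + 1) ↦ evenMomentLM N j) :
      Fin (s + 2) → Module.Dual ℝ (Fin (N + 1) → ℝ)) j.succ = evenMomentLM N j := by
  simp

/-- **"The row defining `P_N(c)` is independent of the moment rows when `N ≥ s + 1`"** (p. 8), PROVED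
by the printed polynomial argument: the pencil is linearly independent.
[cite: Groskin2026, Corollary 2.7, proof (p. 8)] -/
theorem linearIndependent_polePencil {c : ℝ} (hc : 1 < c) {N s : ℕ} (hN : s + 1 ≤ N) :
    LinearIndependent ℝ (Fin.cons (poleRowLM c N) (fun j : Fin (s + 1) ↦ evenMomentLM N j) :
      Fin (s + 2) → Module.Dual ℝ (Fin (N + 1) → ℝ)) := by
  classical
  have hβ := poleBeta_pos hc
  rw [Fintype.linearIndependent_iff]
  intro g hg
  -- evaluate the relation on the coordinate vectors
  have hk : ∀ k : Fin (N + 1),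
      g 0 + (((k : ℕ) : ℝ) ^ 2 + poleBeta c ^ 2) *
        ∑ j : Fin (s + 1), g j.succ * (((k : ℕ) : ℝ) ^ 2) ^ (j : ℕ) = 0 := by
    intro k
    have h := congrArg (fun φ : Module.Dual ℝ (Fin (N + 1) → ℝ) ↦ φ (Pi.single k 1)) hg
    simp only [LinearMap.sum_apply, LinearMap.smul_apply, smul_eq_mul, LinearMap.zero_apply] at h
    rw [Fin.sum_univ_succ] at h
    simp only [polePencil_zero, polePencil_succ, poleRowLM_apply, evenMomentLM_apply,
      poleRow_single, evenMoment_single] at h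
    have hD : 0 < ((k : ℕ) : ℝ) ^ 2 + poleBeta c ^ 2 := by positivity
    have hε := evenWeight_ne_zero k
    have h' : evenWeight k * (g 0 + (((k : ℕ) : ℝ) ^ 2 + poleBeta c ^ 2) *
        ∑ j : Fin (s + 1), g j.succ * (((k : ℕ) : ℝ) ^ 2) ^ (j : ℕ)) = 0 := by
      have : (((k : ℕ) : ℝ) ^ 2 + poleBeta c ^ 2) *
            (g 0 * (evenWeight k / (((k : ℕ) : ℝ) ^ 2 + poleBeta c ^ 2)) +
              ∑ j : Fin (s + 1), g j.succ * (evenWeight k * ((k : ℕ) : ℝ) ^ (2 * (j : ℕ)))) =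
          evenWeight k * (g 0 + (((k : ℕ) : ℝ) ^ 2 + poleBeta c ^ 2) *
            ∑ j : Fin (s + 1), g j.succ * (((k : ℕ) : ℝ) ^ 2) ^ (j : ℕ)) := by
        simp only [mul_add, Finset.mul_sum]
        congr 1
        · field_simp
        · refine Finset.sum_congr rfl fun j _ ↦ ?_
          rw [pow_mul]
          ring
      rw [← this, h, mul_zero]
    exact (mul_eq_zero.mp h').resolve_left hε
  -- the polynomial `R = C g₀ + (X + C β²) · P`, `P = Σ_j C g_{j+1} X^j`, vanishes at the nodes `k²`
  set P : ℝ[X] := ∑ j : Fin (s + 1), C (g j.succ) * X ^ (j : ℕ) with hP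
  set R : ℝ[X] := C (g 0) + (X + C (poleBeta c ^ 2)) * P with hR
  have hRdeg : R.natDegree ≤ s + 1 := by
    have h1 : ((X + C (poleBeta c ^ 2)) * P).natDegree ≤ s + 1 := by
      have hPdeg : P.natDegree ≤ s := by
        refine Polynomial.natDegree_sum_le_of_forall_le _ _ fun j _ ↦ ?_
        exact (Polynomial.natDegree_C_mul_X_pow_le _ _).trans (Nat.le_of_lt_succ j.2)
      refine Polynomial.natDegree_mul_le.trans ?_
      rw [Polynomial.natDegree_X_add_C]; omega
    refine (Polynomial.natDegree_add_le _ _).trans (max_le ?_ h1)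
    rw [Polynomial.natDegree_C]; exact Nat.zero_le _
  have heval : ∀ k : Fin (N + 1), R.eval (((k : ℕ) : ℝ) ^ 2) = 0 := by
    intro k
    rw [hR, hP]
    simp only [eval_add, eval_C, eval_mul, eval_X, eval_finsetSum, eval_pow]
    exact hk k
  have hinj : Function.Injective fun k : Fin (N + 1) ↦ ((k : ℕ) : ℝ) ^ 2 := by
    intro a b hab
    have := (pow_left_inj₀ (Nat.cast_nonneg _) (Nat.cast_nonneg _) two_ne_zero).mp hab
    exact Fin.ext (by exact_mod_cast this)
  have hR0 : R = 0 := by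
    refine Polynomial.eq_zero_of_natDegree_lt_card_of_eval_eq_zero R hinj heval ?_
    rw [Fintype.card_fin]; omega
  -- read off the coefficients: `P = 0` by degree count, then `g₀ = 0`
  have hP0 : P = 0 := by
    by_contra hP0
    have h1 : ((X + C (poleBeta c ^ 2)) * P).natDegree = P.natDegree + 1 := by
      rw [Polynomial.natDegree_mul (Polynomial.X_add_C_ne_zero _) hP0, Polynomial.natDegree_X_add_C]
      ring
    have h2 : (X + C (poleBeta c ^ 2)) * P = -C (g 0) := by
      rw [hR] at hR0
      linear_combination hR0
    rw [h2, Polynomial.natDegree_neg, Polynomial.natDegree_C] at h1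
    omega
  have hg0 : g 0 = 0 := by
    rw [hR, hP0, mul_zero, add_zero, Polynomial.C_eq_zero] at hR0
    exact hR0
  have hgs : ∀ j : Fin (s + 1), g j.succ = 0 := by
    intro j
    have hc := congrArg (fun Q : ℝ[X] ↦ Q.coeff (j : ℕ)) hP0
    simp only [hP, Polynomial.finsetSum_coeff, Polynomial.coeff_C_mul_X_pow,
      Polynomial.coeff_zero] at hc
    rw [Finset.sum_eq_single j] at hc
    · simpa using hc
    · intro j' _ hj'
      rw [if_neg]
      exact fun h ↦ hj' (Fin.ext h).symm
    · simp
  intro i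
  exact Fin.cases hg0 (fun j ↦ hgs j) i

/-- `H_s(N) ∩ P_N(c)` is the joint kernel of the pencil, i.e. the dual coannihilator of its span.
[cite: Groskin2026, Corollary 2.7 (p. 7)] -/
theorem momentNeutral_inf_poleNeutral_eq_dualCoannihilator (c : ℝ) (N s : ℕ) :
    momentNeutral N s ⊓ poleNeutral c N =
      (Submodule.span ℝ (Set.range (Fin.cons (poleRowLM c N) (fun j : Fin (s + 1) ↦ evenMomentLM N j) :
        Fin (s + 2) → Module.Dual ℝ (Fin (N + 1) → ℝ)))).dualCoannihilator := by
  ext v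
  rw [Submodule.mem_dualCoannihilator]
  constructor
  · intro hv φ hφ
    have hsub : Set.range (Fin.cons (poleRowLM c N) (fun j : Fin (s + 1) ↦ evenMomentLM N j) :
        Fin (s + 2) → Module.Dual ℝ (Fin (N + 1) → ℝ)) ⊆
        (LinearMap.ker (Module.Dual.eval ℝ (Fin (N + 1) → ℝ) v) : Set _) := by
      rintro _ ⟨i, rfl⟩
      rw [SetLike.mem_coe, LinearMap.mem_ker, Module.Dual.eval_apply]
      rw [Submodule.mem_inf, momentNeutral, Submodule.mem_iInf, mem_poleNeutral] at hv
      refine Fin.cases ?_ (fun j ↦ ?_) i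
      · rw [polePencil_zero, poleRowLM_apply]; exact hv.2
      · rw [polePencil_succ]; exact hv.1 j
    have := Submodule.span_le.mpr hsub hφ
    rwa [LinearMap.mem_ker, Module.Dual.eval_apply] at this
  · intro hv
    have hi : ∀ i, (Fin.cons (poleRowLM c N) (fun j : Fin (s + 1) ↦ evenMomentLM N j) :
        Fin (s + 2) → Module.Dual ℝ (Fin (N + 1) → ℝ)) i v = 0 :=
      fun i ↦ hv _ (Submodule.subset_span ⟨i, rfl⟩)
    rw [Submodule.mem_inf, momentNeutral, Submodule.mem_iInf, mem_poleNeutral]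
    refine ⟨fun j ↦ ?_, ?_⟩
    · have := hi j.succ
      rwa [polePencil_succ] at this
    · have := hi 0
      rwa [polePencil_zero, poleRowLM_apply] at this

/-- **[Gr26] Corollary 2.7, first clause — PROVED:** `dim(H_s(N) ∩ P_N(c)) = N − s − 1` for `c > 1`
and `N ≥ s + 1` (printed with `N ≥ s + 2`, where the dimension is `> 0`).
[cite: Groskin2026, Corollary 2.7 (p. 7), proof (p. 8)] -/
theorem finrank_momentNeutral_inf_poleNeutral {c : ℝ} (hc : 1 < c) {N s : ℕ} (hN : s + 1 ≤ N) :
    Module.finrank ℝ ↥(momentNeutral N s ⊓ poleNeutral c N) = N - s - 1 := by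
  have hLI := linearIndependent_polePencil hc hN
  have h := Subspace.finrank_add_finrank_dualCoannihilator_eq
    (Submodule.span ℝ (Set.range (Fin.cons (poleRowLM c N) (fun j : Fin (s + 1) ↦ evenMomentLM N j) :
      Fin (s + 2) → Module.Dual ℝ (Fin (N + 1) → ℝ))))
  rw [finrank_span_eq_card hLI, Fintype.card_fin, ← momentNeutral_inf_poleNeutral_eq_dualCoannihilator,
    Module.finrank_fin_fun] at h
  omega

/-- The printed form: for `N ≥ s + 2` the dimension is `N − s − 1` and is positive (the family is
nonempty). [cite: Groskin2026, Corollary 2.7 (p. 7)] -/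
theorem corollary_2_7_dim {c : ℝ} (hc : 1 < c) {N s : ℕ} (hN : s + 2 ≤ N) :
    Module.finrank ℝ ↥(momentNeutral N s ⊓ poleNeutral c N) = N - s - 1 ∧ 0 < N - s - 1 :=
  ⟨finrank_momentNeutral_inf_poleNeutral hc (by omega), by omega⟩

/-- In particular, for `N ≥ s + 2` the family `H_s(N) ∩ P_N(c)` contains a nonzero vector.
[cite: Groskin2026, Corollary 2.7 (p. 7)] -/
theorem exists_ne_zero_mem_momentNeutral_inf_poleNeutral {c : ℝ} (hc : 1 < c) {N s : ℕ}
    (hN : s + 2 ≤ N) : ∃ v ∈ momentNeutral N s ⊓ poleNeutral c N, v ≠ 0 := by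
  have hpos : 0 < Module.finrank ℝ ↥(momentNeutral N s ⊓ poleNeutral c N) := by
    rw [finrank_momentNeutral_inf_poleNeutral hc (by omega)]; omega
  obtain ⟨w, hw⟩ := Module.finrank_pos_iff_exists_ne_zero.mp hpos
  exact ⟨w, w.2, fun h ↦ hw (Subtype.ext h)⟩

end Groskin2026

end Literature.NumberTheory.LFunctions

end
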